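import Summits.BirchSwinnertonDyer.BirchSwinnertonDyer.Theorems.SignedBaseChangeAnticyclotomicEisensteinDivisibilityAdmdefOrdLineNonzero
import Summits.BirchSwinnertonDyer.BirchSwinnertonDyer.Theorems.SignedBaseChangeAnticyclotomicEisensteinDivisibilityAdmdefCoreRootOfSeenAnchor
import Literature.GroupTheory.FreeProcyclicQuotientRetraction
import HarnessLib

/-!
# Line `admdef` (crux `AnticyclotomicEisensteinDivisibility`, stmt-BirchSwinnertonDyer-20727), rigidity road, (M2) unramified twin:
# THE FROBENIUS TARGET `H¹(⟨φ⟩, E[p])` AT AN ADMISSIBLE PRIME IS NON-ZERO, and Howard's DESCENT step `mq → m` (second law,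
# converse) WITHOUT the local witness hypothesis — so a unit `λ_1(q)(0)` at ANY single admissible prime gives `κ_1(1)_0 ≠ 0`

LEAD seat bsd-line-sbc-p1 (gen 28), `--supports stmt-BirchSwinnertonDyer-20727` (helper; OFF the v23 composition path, rigidity road of
`Lines/admdef-lead-g25.md` §4).  LEAD g24/g25 read the SECOND reciprocity law of a signed bipartite system (CHKLL25 Thm. 7.4 as typed) in the
converse direction «`λ_1(mq)(0) ∈ ℤ_pˣ ⟹ res_{⟨φ⟩}(κ_1(m)_0) ≠ 0`» GIVEN a non-zero element `u` of the Frobenius target `H¹(⟨φ⟩, E[p])`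
(`…AdmdefRootVisibleOfUnitLambda`, `…AdmdefBipartitePropagation` §2), and obtained `u` only as the restriction of a VISIBLE global class
(Čebotarev, `…AdmdefRootZero`; hence the «seen anchor» shape of `…AdmdefCoreRootOfSeenAnchor`).  LEAD g27 removed the analogous witness of
the FIRST law (`…AdmdefOrdLineNonzero`: `ordLine 𝔓₀ ≠ ⊥`).  THIS FILE removes the witness of the second law:

* §1 `exists_fixed_forall_isArithFrobAt` — at every prime `𝔓 ∣ v ∋ q` of `K̄` (`q` Bertolini–Darmon `1`-admissible, `[K : ℚ] = 2`) there is
  `P ∈ E(K̄)[p]`, `P ≠ 0`, FIXED by every arithmetic Frobenius at `𝔓` (the `ε`-eigenline of `ρ̄(Frob_q) ∼ diag(ε, εq)` read over `K`: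
  `Frob_v = Frob_q²`, `ε² = 1`; AKR `frob_sq_ne_one_and_exists_fixed_of_isAdmissiblePrime` + inertia acts trivially at the good place `v ∤ p`).
* §2 `exists_torsionH1Over_zpowers_ne_zero` — for an arithmetic Frobenius `φ ∈ D_{𝔓₀}` at the chosen prime `𝔓₀ = adicCompletionPrime K v`:
  **`H¹(⟨φ⟩, E[p]) ≠ 0`** (the tree's `torsionH1Over ((p:ℤ)^1) (zpowers φ)`: continuous cochains on `⟨φ⟩ ≤ Γ_K` with its subspace topology).
  PROOF: `φ = res φ_v` for a Frobenius `φ_v` of the local field `K_v` (`D_{𝔓₀} = res(Γ_{K_v})`); the closed procyclic group `cl⟨φ_v⟩ ≅ Ẑ`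
  (`Γ_{K_v}/I_{K_v}` free procyclic, `Literature.GroupTheory.isFreeProcyclic_topologicalClosure_zpowers`) carries, for every `t ∈ E[p]`, a
  continuous cocycle `y` with `y(φ_v) = t` (`exists_contOneCocycles_apply_eq_of_finite`, Serre XIII §1); transport `y` along the continuous
  inverse of the closed embedding `res` on `⟨φ⟩` (`exists_continuousMonoidHom_absGaloisRestrict_apply_eq`); choose `t ∉ (φ − 1)E[p]` — possible
  because `φ − 1` kills the fixed vector of §1, so is not injective, so NOT SURJECTIVE on the finite set `E[p]` — then the class of the
  transported cocycle is non-zero (a coboundary takes the value `(φ − 1)a` at `φ`).  This is «`H¹_unr(K_𝔮, E[p]) ≅ E[p]/(Frob_𝔮 − 1) ≅ 𝔽_p ≠ 0`»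
  ([Howard2006] Lem. 2.2.1, the target line of the SECOND law) in CHKLL25's Frobenius currency.
* §3 PAYOFF (witness-free): `res_kappa_layer_zero_ne_zero_of_isUnit_lam_adicCompletionPrime` / `kappa_layer_zero_ne_zero_of_isUnit_lam_mul_adicCompletionPrime`
  — Howard's DESCENT `mq → m` at any indefinite vertex `m`: `λ_1(mq)(0) ∈ ℤ_pˣ ⟹ κ_1(m)_0` visible at `q`, hence `≠ 0`; the edge `m — mq` read
  both ways (`isUnit_lam_mul_iff_res_kappa_ne_zero_adicCompletionPrime`); at the ROOT: `kappa_one_layer_zero_ne_zero_of_isUnit_lam_adicCompletionPrime`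
  and `limitBaseClass_layer_zero_one_ne_zero_of_isUnit_lam_adicCompletionPrime` — **a unit `λ_1(q)(0)` at ONE (any) `1`-admissible prime `q`
  forces `z_{0,1} ≠ 0`** (g25's `…_of_seenAnchor` with the Selmer/visibility hypothesis GONE; the `d = 1` anchor ⟹ (RV₁)H-pinned, no «seen»).

HONEST FRAMING: theorems only (no definition, no named fact, no `sorry`); kernel Galois cohomology over the tree's predicates; stated at the
chosen prime `𝔓₀` over `v` (all primes over `v` are conjugate; not needed).  Nothing about the crux, the anchors (K1) or BSD is asserted.

References: [cite: Howard2006, Lem. 2.2.1, Lem. 2.3.3, Thm. 3.2.3] [cite: CastellaEtAl2025, Thm. 7.4 second law (arXiv:2308.10474v2 p0030 L50–L52)]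
[cite: SerreLocalFields1979, XIII §1 Prop. 1] [cite: NeukirchSchmidtWingberg2008, Thm. 7.5.3] [cite: NeukirchANT1999, Ch. II §9 Prop. (9.6)]
[cite: BertoliniDarmon2005, p. 18] [cite: WZhang2014, Notations (xiv)].
-/

-- D-0017: single-problem summit, the namespace repeats the problem name by design.
set_option linter.dupNamespace false
set_option autoImplicit false

noncomputable section

open scoped Classical NumberField

namespace Summit.BirchSwinnertonDyer.BirchSwinnertonDyer.Theorems.SignedBaseChangeAcDivAdmdefUnrLineNonzero

open WeierstrassCurve NumberField IsDedekindDomain Field Topology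
open Literature.NumberTheory.EllipticCurves Literature.NumberTheory.GaloisRepresentations
open Literature.NumberTheory.GaloisRepresentations.IsNonarchimedeanLocalField
open Literature.NumberTheory.EllipticCurves.CastellaHsuKunduLeeLiu2025
open Literature.NumberTheory.EllipticCurves.BertoliniDarmon2005
open Literature.NumberTheory.GaloisCohomology.Howard2004
open Literature.GroupTheory
open Summit.BirchSwinnertonDyer.BirchSwinnertonDyer.Theorems.AdditiveKoly
open Summit.BirchSwinnertonDyer.Rank1Residual.X11b.Three.Koly.Method2
open Summit.BirchSwinnertonDyer.BirchSwinnertonDyer.Theorems.SignedBaseChangeAcDivAdmdefOrdLineNonzero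
open Summit.BirchSwinnertonDyer.BirchSwinnertonDyer.Theorems.SignedBaseChangeAcDivAdmdefBipartitePropagation
open Summit.BirchSwinnertonDyer.BirchSwinnertonDyer.Theorems.SignedBaseChangeAcDivAdmdefUnitLambdaOfLoc
open Summit.BirchSwinnertonDyer.BirchSwinnertonDyer.Theorems.SignedBaseChangeAcDivAdmdefRootVisibleOfUnitLambda

universe u

/-! ## §1 The fixed line of the Frobenius at a prime over an admissible `q` (the `ε`-eigenline read over `K`) -/

section Fixed

variable (W : WeierstrassCurve ℚ) [W.IsElliptic] [W.IsGloballyMinimal] (K : Type) [Field K] [NumberField K]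

/-- **A non-zero vector of `E(K̄)[p]` fixed by EVERY arithmetic Frobenius at `𝔓 ∣ v ∋ q`** (`[K : ℚ] = 2`, `q` Bertolini–Darmon
`1`-admissible, `v` the place of `K` over the inert `q`, `𝔓` any prime of `\bar ℤ_K` over `v`).  Construction (as in
`AdditiveKoly.exists_frob_of_isAdmissiblePrime` and `…AdmdefAdmissibleEigenline` §2–§3): an arithmetic Frobenius `h ∈ Γ_ℚ` at `𝔓 ∩ \bar ℤ` has an
`ε`-eigenvector `P₂ ≠ 0`, `ε = ±1` (`frob_sq_ne_one_and_exists_fixed_of_isAdmissiblePrime`); `h² = res F` with `F` a Frobenius at `𝔓`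
(`f(v|q) = 2`), and `F` acts on `E(K̄)[p] ≃ E(ℚ̄)[p]` as `h²`, so `F` fixes `θ P₂` (`ε² = 1`); any other arithmetic Frobenius at `𝔓` differs from
`F` by inertia, which fixes `E[p]` at the good place `v ∤ p`.  This is the line `𝔽_p` of `E[p] ≅ 𝔽_p ⊕ μ_p` as a `Gal(K̄_𝔮/K_𝔮)`-module.
[cite: BertoliniDarmon2005, p. 18] [cite: WZhang2014, Notations (xiv)] [cite: Howard2006, Lem. 2.2.1] [cite: SilvermanAEC2009, Prop. VII.4.1] -/
theorem exists_fixed_forall_isArithFrobAt (hK2 : Module.finrank ℚ K = 2) {p : ℕ} [Fact p.Prime] {q : ℕ}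
    (hq : IsAdmissiblePrime (W.conductorNorm ℤ) K (fun ℓ ↦ W.frobeniusTrace ℓ) p 1 q)
    (v : HeightOneSpectrum (𝓞 K)) (hqv : (q : 𝓞 K) ∈ v.asIdeal)
    {𝔓 : Ideal (absIntegers (𝓞 K) K)} (h𝔓 : 𝔓 ∈ v.primesAbove) {n : ℤ} (hn : n = (p : ℤ)) :
    ∃ P : geomTorsion (W.baseChange K) n, P ≠ 0 ∧
      ∀ F : absoluteGaloisGroup K, IsArithFrobAt (𝓞 K) F 𝔓 → F • P = P := by
  subst hn
  -- adapted from Theorems/AdditiveKolyvaginRoadLocalFrobenius.lean `exists_frob_of_isAdmissiblePrime`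
  haveI : Algebra.IsQuadraticExtension ℚ K := ⟨hK2⟩
  have hq' := hq
  obtain ⟨hqprime, -, hinert, -, -⟩ := hq'
  set w : HeightOneSpectrum (𝓞 ℚ) := v.under (𝓞 ℚ) with hw
  have hwv : v.asIdeal.under (𝓞 ℚ) = w.asIdeal := rfl
  have hqw : (q : 𝓞 ℚ) ∈ w.asIdeal := by
    rw [← hwv, Ideal.under_def, Ideal.mem_comap, map_natCast]; exact hqv
  set 𝔓' := 𝔓.comap (absIntegersMap ℚ K) with h𝔓'def
  have h𝔓' : 𝔓' ∈ w.primesAbove := comap_absIntegersMap_mem_primesAbove hwv h𝔓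
  haveI := h𝔓'.1
  -- an arithmetic Frobenius `h ∈ Γ_ℚ` at `𝔓'` and its `ε`-eigenvector on `E(ℚ̄)[p]`
  obtain ⟨h, hh⟩ := HeightOneSpectrum.exists_isArithFrobAt_of_mem_primesAbove_holds h𝔓'
  obtain ⟨-, ε, P₂, hε, hP₂0, hP₂⟩ := frob_sq_ne_one_and_exists_fixed_of_isAdmissiblePrime W hq hqw h𝔓' hh
  -- `h² = res F`, `F` a Frobenius at `𝔓`
  obtain ⟨F, hF⟩ := LocalFrob.sq_mem_range_absGaloisRestrict K hK2 h
  have hf2 := LocalFrob.inertiaDeg_eq_two_of_isPrime_span K hK2 hqprime hinert v hqv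
  have hFrobF : IsArithFrobAt (𝓞 K) F 𝔓 :=
    isArithFrobAt_of_absGaloisRestrict_eq_pow (F := ℚ) (M := K) hwv h𝔓 hh (by rw [hF, hf2])
  -- `F` acts on `E(K̄)[p]` as `h²` through `θ : E(ℚ̄)[p] ≃ E(K̄)[p]`
  set θ := RatClosure.torsionEquiv (K := K) W (p : ℤ) with hθ
  have hFθ : ∀ P : geomTorsion W (p : ℤ), F • θ P = θ (h • h • P) := fun P ↦ by
    rw [← RatClosure.torsionEquiv_smul, hF, pow_two, mul_smul]
  have hfix : F • θ P₂ = θ P₂ := by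
    rw [hFθ, hP₂, smul_comm h ε P₂, hP₂, smul_smul]
    rcases hε with rfl | rfl <;> simp
  -- inertia at the good place `v ∤ p` acts trivially on `E[p]`
  obtain ⟨hgood, hpv⟩ := hasGoodReductionAt_of_isAdmissiblePrime W K hq v hqv
  have hI : ∀ τ ∈ 𝔓.inertia (absoluteGaloisGroup K), ∀ Q : geomTorsion (W.baseChange K) (p : ℤ), τ • Q = Q :=
    fun τ hτ Q ↦ (W.baseChange K).smul_geomTorsion_eq_of_mem_inertia hgood hpv h𝔓 hτ Q
  refine ⟨θ P₂, fun h0 ↦ hP₂0 (θ.injective (by rw [h0, map_zero])), fun F' hF' ↦ ?_⟩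
  have hmem : F' * F⁻¹ ∈ 𝔓.inertia (absoluteGaloisGroup K) := hF'.mul_inv_mem_inertia hFrobF
  calc F' • θ P₂ = (F' * F⁻¹ * F) • θ P₂ := by rw [inv_mul_cancel_right]
    _ = (F' * F⁻¹) • (F • θ P₂) := mul_smul _ _ _
    _ = θ P₂ := by rw [hfix, hI _ hmem]

end Fixed

/-! ## §2 `H¹(⟨φ⟩, E[p]) ≠ 0` for an arithmetic Frobenius `φ` at the chosen prime over an admissible `q` -/

section UnrLine

variable (W : WeierstrassCurve ℚ) [W.IsElliptic] [W.IsGloballyMinimal] (K : Type) [Field K] [NumberField K]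

/-- **The Frobenius target of the second reciprocity law is non-zero: `H¹(⟨φ⟩, E[p]) ≠ 0`** ([Howard2006] Lem. 2.2.1, `H¹_unr(K_𝔮, E[p]) ≅
E[p]/(Frob_𝔮 − 1) ≅ 𝔽_p`, in CHKLL25's currency).  `E = W/ℚ` elliptic in global minimal form, `[K : ℚ] = 2`, `p` prime, `q` a Bertolini–Darmon
`1`-admissible prime for `(E, K, p)`, `v ∋ q` the place of `K` over `q`, `𝔓₀ = adicCompletionPrime K v` the prime of `\bar ℤ_K` over `v` cut out
by the chosen embedding `K̄ → K̄_v`, and `φ ∈ D_{𝔓₀}` ANY arithmetic Frobenius at `𝔓₀`.  Then the continuous cohomology group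
`H¹(⟨φ⟩, E[p])` of the cyclic subgroup `⟨φ⟩ ≤ Γ_K` (subspace topology) has a NON-ZERO element.  Construction in the module docstring
(procyclic closure of a local Frobenius, Serre XIII §1, transport along `Γ_{K_v} ≅ D_{𝔓₀}`, value `t ∉ (φ − 1)E[p]` at `φ`).
[cite: Howard2006, Lem. 2.2.1] [cite: SerreLocalFields1979, XIII §1 Prop. 1] [cite: NeukirchSchmidtWingberg2008, Thm. 7.5.3]
[cite: NeukirchANT1999, Ch. II §9 Prop. (9.6)] -/
theorem exists_torsionH1Over_zpowers_ne_zero (hK2 : Module.finrank ℚ K = 2) {p : ℕ} [Fact p.Prime]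
    {q : ℕ} (hq : IsAdmissiblePrime (W.conductorNorm ℤ) K (fun ℓ ↦ W.frobeniusTrace ℓ) p 1 q)
    (v : HeightOneSpectrum (𝓞 K)) (hqv : (q : 𝓞 K) ∈ v.asIdeal)
    {φ : absoluteGaloisGroup K} (hφD : φ ∈ (adicCompletionPrime K v).decompositionSubgroup (absoluteGaloisGroup K))
    (hφF : IsArithFrobAt (𝓞 K) φ (adicCompletionPrime K v)) :
    ∃ u : (W.baseChange K).torsionH1Over ((p : ℤ) ^ 1) (Subgroup.zpowers φ), u ≠ 0 := by
  classical
  have hp : p.Prime := Fact.out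
  -- (1) a non-zero vector fixed by `φ`, so `φ − 1` is not surjective on the finite set `E[p]`
  obtain ⟨P, hP0, hPfix⟩ := exists_fixed_forall_isArithFrobAt W K hK2 hq v hqv
    (adicCompletionPrime_mem_primesAbove K v) (n := (p : ℤ) ^ 1) (pow_one _)
  have hcard : Nat.card (geomTorsion (W.baseChange K) ((p : ℤ) ^ 1)) = p ^ 2 := by
    rw [pow_one]
    exact card_torsionPoints_eq_sq_holds (W.baseChange K) (AlgebraicClosure K) (n := p) (by exact_mod_cast hp.ne_zero)
  haveI : Finite (geomTorsion (W.baseChange K) ((p : ℤ) ^ 1)) :=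
    Nat.finite_of_card_ne_zero (by rw [hcard]; exact pow_ne_zero 2 hp.ne_zero)
  set g : geomTorsion (W.baseChange K) ((p : ℤ) ^ 1) → geomTorsion (W.baseChange K) ((p : ℤ) ^ 1) :=
    fun x ↦ φ • x - x with hgdef
  have hginj : ¬ Function.Injective g := by
    intro hinj
    apply hP0
    apply hinj
    show φ • P - P = φ • (0 : geomTorsion (W.baseChange K) ((p : ℤ) ^ 1)) - 0
    rw [hPfix φ hφF, sub_self, smul_zero, sub_self]
  have hgsurj : ¬ Function.Surjective g := fun hs ↦ hginj (Finite.injective_iff_surjective.mpr hs)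
  obtain ⟨t, ht⟩ : ∃ t : geomTorsion (W.baseChange K) ((p : ℤ) ^ 1), ∀ a, g a ≠ t := by
    by_contra hcon
    push Not at hcon
    exact hgsurj fun t ↦ hcon t
  -- (2) `φ = res φ_v` for a Frobenius `φ_v` of `K_v`
  have hφrange : φ ∈ (absGaloisRestrict K (v.adicCompletion K)).toMonoidHom.range := by
    rw [← decompositionSubgroup_adicCompletionPrime_eq_range]; exact hφD
  obtain ⟨φv, hφv⟩ := hφrange
  have hφv' : absGaloisRestrict K (v.adicCompletion K) φv = φ := hφv
  have hfrob : IsAbsArithFrob φv :=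
    (isArithFrobAt_absGaloisRestrict_adicCompletionPrime_iff K v (residueFieldCard_adicCompletion_eq_natCard v) φv).mp
      (by rw [hφv']; exact hφF)
  -- (3) the local representation and a continuous cocycle `y` of `cl⟨φ_v⟩` with `y(φ_v) = t`
  let τ : ContinuousRep (absoluteGaloisGroup (v.adicCompletion K)) ℤ (geomTorsion (W.baseChange K) ((p : ℤ) ^ 1)) :=
    ((W.baseChange K).torsionGaloisModule ((p : ℤ) ^ 1)).restrict (absGaloisRestrict K (v.adicCompletion K))
  have hτapp : ∀ (g : absoluteGaloisGroup (v.adicCompletion K)) (m : geomTorsion (W.baseChange K) ((p : ℤ) ^ 1)),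
      τ g m = absGaloisRestrict K (v.adicCompletion K) g • m := fun _ _ ↦ rfl
  haveI := absoluteGaloisGroup_compactSpace (v.adicCompletion K)
  haveI : (absInertia (v.adicCompletion K)).Normal := absInertia_normal_holds (v.adicCompletion K)
  set C : Subgroup (absoluteGaloisGroup (v.adicCompletion K)) := (Subgroup.zpowers φv).topologicalClosure with hCdef
  obtain ⟨y, hy⟩ := exists_contOneCocycles_apply_eq_of_finite τ C (Subgroup.isClosed_topologicalClosure _)
    (dense_zpowers_mk_topologicalClosure' φv)
    (exists_isOpen_index_topologicalClosure_zpowers (absInertia (v.adicCompletion K))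
      (isClosed_absInertia_holds (v.adicCompletion K)) (isFreeProcyclic_quotient_absInertia' (v.adicCompletion K)) φv
      (dense_zpowers_mk_absInertia_of_isFrobPow (v.adicCompletion K) (IsAbsArithFrob.isFrobPow_holds hfrob))) t
  -- (4) the continuous inverse `e` of `res` on `H = ⟨φ⟩`, with values in `C`
  have hinj := absGaloisRestrict_adicCompletion_injective K v
  set H : Subgroup (absoluteGaloisGroup K) := Subgroup.zpowers φ with hHdef
  have hH : H ≤ (absGaloisRestrict K (v.adicCompletion K)).toMonoidHom.range :=
    (Subgroup.zpowers_le (G := absoluteGaloisGroup K)).mpr ⟨φv, hφv⟩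
  obtain ⟨e, he⟩ := exists_continuousMonoidHom_absGaloisRestrict_apply_eq K v H hH
  have heφ : ∀ k : ℤ, e ⟨φ ^ k, Subgroup.zpow_mem_zpowers φ k⟩ = φv ^ k := fun k ↦
    hinj (by rw [he, map_zpow, hφv'])
  have heC : ∀ x : H, e x ∈ C := by
    intro x
    obtain ⟨k, hk⟩ := Subgroup.mem_zpowers_iff.mp x.2
    have hx : x = ⟨φ ^ k, Subgroup.zpow_mem_zpowers φ k⟩ := Subtype.ext hk.symm
    rw [hx, heφ]
    exact Subgroup.le_topologicalClosure _ (Subgroup.zpow_mem_zpowers φv k)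
  let e' : H → C := fun x ↦ ⟨e x, heC x⟩
  have he'cont : Continuous e' := e.continuous_toFun.subtype_mk _
  have he'mul : ∀ x x' : H, e' (x * x') = e' x * e' x' := fun x x' ↦ Subtype.ext (by
    change e (x * x') = e x * e x'
    rw [map_mul])
  -- (5) the transported cocycle `ζ` of `⟨φ⟩`
  let ζ : contOneCocycles (discreteTopRep H (geomTorsion (W.baseChange K) ((p : ℤ) ^ 1))) :=
    ⟨ContinuousMap.mk (fun x ↦ y.1 (e' x)) (y.1.continuous.comp he'cont), fun x x' ↦ by
      change y.1 (e' (x * x')) = y.1 (e' x) + (discreteTopRep H (geomTorsion (W.baseChange K) ((p : ℤ) ^ 1))).ρ x (y.1 (e' x'))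
      rw [he'mul, y.2 (e' x) (e' x'), discreteTopRep_ρ_apply]
      change y.1 (e' x) + τ (e x) (y.1 (e' x')) = _
      rw [hτapp, he]
      rfl⟩
  have hζφ : ζ.1 ⟨φ, Subgroup.mem_zpowers φ⟩ = t := by
    change y.1 (e' ⟨φ, Subgroup.mem_zpowers φ⟩) = t
    have h1 : e' ⟨φ, Subgroup.mem_zpowers φ⟩ = ⟨φv, Subgroup.le_topologicalClosure _ (Subgroup.mem_zpowers φv)⟩ := by
      apply Subtype.ext
      change e ⟨φ, Subgroup.mem_zpowers φ⟩ = φv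
      have h2 := heφ 1
      simp only [zpow_one] at h2
      exact h2
    rw [h1]
    exact hy
  -- (6) its class is non-zero: a coboundary takes the value `(φ − 1)a` at `φ`
  refine ⟨oneCocycleClass _ ζ, fun h0 ↦ ?_⟩
  rw [oneCocycleClass_eq_zero_iff] at h0
  obtain ⟨a, ha⟩ := h0
  have h1 := ha ⟨φ, Subgroup.mem_zpowers φ⟩
  rw [hζφ, discreteTopRep_ρ_apply] at h1
  exact ht a (by rw [hgdef]; exact h1.symm)

/-- **The same for the anticyclotomic tower, with a Frobenius IN `Gal(K̄/K_∞)`**: `K` imaginary quadratic, `κ` anticyclotomic, `q` BD-admissible,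
`v ∋ q`: there is an arithmetic Frobenius `φ ∈ D_{𝔓₀} ∩ ker κ` at `𝔓₀ = adicCompletionPrime K v` (any local Frobenius restricted to `K̄`; `D_v ≤
ker κ` since the inert `q ∤ p` splits completely in `K_∞/K`, `ZpExtension.decomp_le_kerSubgroup_of_span_natCast`), and for every such `φ` the target
`H¹(⟨φ⟩, E[p])` is non-zero. [cite: Howard2006, Lem. 2.2.1, Lem. 3.1.2] [cite: CastellaEtAl2025, §7.2 (arXiv:2308.10474v2 p0030 L20–L27)] -/
theorem exists_isArithFrobAt_mem_kerSubgroup (hK : IsImaginaryQuadratic K) {p : ℕ} [Fact p.Prime]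
    (κ : ZpExtension K p) (hκ : κ.IsAnticyclotomic)
    {q : ℕ} (hq : IsAdmissiblePrime (W.conductorNorm ℤ) K (fun ℓ ↦ W.frobeniusTrace ℓ) p 1 q)
    (v : HeightOneSpectrum (𝓞 K)) (hqv : (q : 𝓞 K) ∈ v.asIdeal) :
    ∃ φ : absoluteGaloisGroup K, φ ∈ κ.kerSubgroup ∧
      φ ∈ (adicCompletionPrime K v).decompositionSubgroup (absoluteGaloisGroup K) ∧
      IsArithFrobAt (𝓞 K) φ (adicCompletionPrime K v) := by
  have hq' := hq
  obtain ⟨hqprime, -, hinert, -, -⟩ := hq'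
  obtain ⟨-, hpv⟩ := hasGoodReductionAt_of_isAdmissiblePrime W K hq v hqv
  have hpv' : ((p : ℕ) : 𝓞 K) ∉ v.asIdeal := by rw [← Int.cast_natCast]; exact hpv
  have hbot : Ideal.span {((q : ℕ) : 𝓞 K)} ≠ ⊥ := by
    rw [Ne, Ideal.span_singleton_eq_bot]; exact_mod_cast hqprime.ne_zero
  have hspan : v.asIdeal = Ideal.span {((q : ℕ) : 𝓞 K)} :=
    ((hinert.isMaximal hbot).eq_of_le v.isPrime.ne_top ((Ideal.span_singleton_le_iff_mem _).mpr hqv)).symm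
  obtain ⟨φv, hφv⟩ := exists_isAbsArithFrob_holds (F := v.adicCompletion K)
  refine ⟨absGaloisRestrict K (v.adicCompletion K) φv, ?_, ?_, ?_⟩
  · exact ZpExtension.decomp_le_kerSubgroup_of_span_natCast (κ := κ) hK hκ hpv' hspan ⟨φv, rfl⟩
  · rw [decompositionSubgroup_adicCompletionPrime_eq_range]; exact ⟨φv, rfl⟩
  · exact (isArithFrobAt_absGaloisRestrict_adicCompletionPrime_iff K v (residueFieldCard_adicCompletion_eq_natCard v) φv).mpr hφv

end UnrLine

/-! ## §3 Payoff: Howard's descent `mq → m` and the root, witness-free -/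

section Descent

variable {K : Type} [Field K] [NumberField K] {W : WeierstrassCurve ℚ} [W.IsElliptic] [W.IsGloballyMinimal] {p : ℕ} [Fact p.Prime]
  {κ : ZpExtension K p} {γ : absoluteGaloisGroup K} {N : ℕ} {ε : ℤˣ} {B : SignedBipartiteSystem W K p κ}

/-- **The edge `m — mq` read both ways at `𝔓₀`, NO local witness: `λ_1(mq)(0) ∈ ℤ_pˣ ⟺ res_{⟨φ⟩}(κ_1(m)_0) ≠ 0`** for a signed bipartite system at
level `N = N_E` over a quadratic `K`, `mq ∈ 𝒩_1^def`, `q` `1`-admissible not dividing `m`, `v ∋ q`, `φ ∈ D_{𝔓₀} ∩ Gal(K̄/K_∞)` an arithmetic Frobenius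
at `𝔓₀ = adicCompletionPrime K v`: LEAD g25's `isUnit_lam_mul_iff_res_kappa_ne_zero` with its witness supplied by `exists_torsionH1Over_zpowers_ne_zero`.
Howard's dichotomy at the definite vertex `mq` adjacent to `m`, modulo `𝔪 = (p, T)`. [cite: Howard2006, Lem. 2.3.3, Thm. 3.2.3 (c)]
[cite: CastellaEtAl2025, Thm. 7.4 second law (arXiv:2308.10474v2 p0030 L50–L52)] -/
theorem isUnit_lam_mul_iff_res_kappa_ne_zero_adicCompletionPrime (hB : IsSignedBipartiteSystem W K p κ γ N ε B)
    (hN : (N : ℤ) = W.conductorNorm ℤ) (hK2 : Module.finrank ℚ K = 2) {m q : ℕ}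
    (hmq : m * q ∈ defProducts N K (fun ℓ ↦ W.frobeniusTrace ℓ) p 1)
    (hq : IsAdmissiblePrime N K (fun ℓ ↦ W.frobeniusTrace ℓ) p 1 q) (hqm : ¬ q ∣ m)
    {v : HeightOneSpectrum (𝓞 K)} (hv : ((q : ℕ) : 𝓞 K) ∈ v.asIdeal)
    {φ : absoluteGaloisGroup K} (hφ : φ ∈ κ.kerSubgroup)
    (hφD : φ ∈ (adicCompletionPrime K v).decompositionSubgroup (absoluteGaloisGroup K))
    (hφF : IsArithFrobAt (𝓞 K) φ (adicCompletionPrime K v)) :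
    IsUnit (PowerSeries.constantCoeff (B.lam 1 (m * q))) ↔
      resOfLe (geomTorsion (W.baseChange K) ((p : ℤ) ^ 1))
        ((Subgroup.zpowers_le.mpr hφ).trans (κ.kerSubgroup_le_layerSubgroup 0)) (B.kappa 1 m 0) ≠ 0 := by
  have hN' : N = W.conductorNorm ℤ := by exact_mod_cast hN
  have hqE : IsAdmissiblePrime (W.conductorNorm ℤ) K (fun ℓ ↦ W.frobeniusTrace ℓ) p 1 q := hN' ▸ hq
  obtain ⟨u, hu⟩ := exists_torsionH1Over_zpowers_ne_zero W K hK2 hqE v hv hφD hφF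
  exact isUnit_lam_mul_iff_res_kappa_ne_zero hB hmq hq hqm hv (adicCompletionPrime_mem_primesAbove K v) hφ hφD hφF u hu

/-- **Howard's DESCENT at `𝔓₀`, witness-free: `λ_1(mq)(0) ∈ ℤ_pˣ ⟹ res_{⟨φ⟩}(κ_1(m)_0) ≠ 0`** (the class `κ_1(m)_0` is VISIBLE at `q`).
[cite: Howard2006, Lem. 2.3.3, Thm. 3.2.3] [cite: CastellaEtAl2025, Thm. 7.4 second law] -/
theorem res_kappa_layer_zero_ne_zero_of_isUnit_lam_adicCompletionPrime (hB : IsSignedBipartiteSystem W K p κ γ N ε B)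
    (hN : (N : ℤ) = W.conductorNorm ℤ) (hK2 : Module.finrank ℚ K = 2) {m q : ℕ}
    (hmq : m * q ∈ defProducts N K (fun ℓ ↦ W.frobeniusTrace ℓ) p 1)
    (hq : IsAdmissiblePrime N K (fun ℓ ↦ W.frobeniusTrace ℓ) p 1 q) (hqm : ¬ q ∣ m)
    {v : HeightOneSpectrum (𝓞 K)} (hv : ((q : ℕ) : 𝓞 K) ∈ v.asIdeal)
    {φ : absoluteGaloisGroup K} (hφ : φ ∈ κ.kerSubgroup)
    (hφD : φ ∈ (adicCompletionPrime K v).decompositionSubgroup (absoluteGaloisGroup K))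
    (hφF : IsArithFrobAt (𝓞 K) φ (adicCompletionPrime K v))
    (hlam : IsUnit (PowerSeries.constantCoeff (B.lam 1 (m * q)))) :
    resOfLe (geomTorsion (W.baseChange K) ((p : ℤ) ^ 1))
      ((Subgroup.zpowers_le.mpr hφ).trans (κ.kerSubgroup_le_layerSubgroup 0)) (B.kappa 1 m 0) ≠ 0 :=
  (isUnit_lam_mul_iff_res_kappa_ne_zero_adicCompletionPrime hB hN hK2 hmq hq hqm hv hφ hφD hφF).mp hlam

/-- **Howard's DESCENT, class form: `λ_1(mq)(0) ∈ ℤ_pˣ ⟹ κ_1(m)_0 ≠ 0`** for a signed bipartite system at level `N = N_E` over an imaginary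
quadratic `K` with anticyclotomic `κ`, `mq ∈ 𝒩_1^def`, `q` `1`-admissible with `q ∤ m` (the Frobenius at `𝔓₀` inside `Gal(K̄/K_∞)` is supplied by
`exists_isArithFrobAt_mem_kerSubgroup`).  LEAD g25's `kappa_layer_zero_ne_zero_of_isUnit_lam_mul` with NO local witness hypothesis.
[cite: Howard2006, Lem. 2.3.3, Thm. 3.2.3] [cite: BurungaleCastellaKim2021, arXiv:1908.09512 Lem. 7.3] -/
theorem kappa_layer_zero_ne_zero_of_isUnit_lam_mul_adicCompletionPrime (hB : IsSignedBipartiteSystem W K p κ γ N ε B)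
    (hN : (N : ℤ) = W.conductorNorm ℤ) (hK : IsImaginaryQuadratic K) (hκ : κ.IsAnticyclotomic) {m q : ℕ}
    (hmq : m * q ∈ defProducts N K (fun ℓ ↦ W.frobeniusTrace ℓ) p 1)
    (hq : IsAdmissiblePrime N K (fun ℓ ↦ W.frobeniusTrace ℓ) p 1 q) (hqm : ¬ q ∣ m)
    {v : HeightOneSpectrum (𝓞 K)} (hv : ((q : ℕ) : 𝓞 K) ∈ v.asIdeal)
    (hlam : IsUnit (PowerSeries.constantCoeff (B.lam 1 (m * q)))) : B.kappa 1 m 0 ≠ 0 := by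
  have hN' : N = W.conductorNorm ℤ := by exact_mod_cast hN
  have hqE : IsAdmissiblePrime (W.conductorNorm ℤ) K (fun ℓ ↦ W.frobeniusTrace ℓ) p 1 q := hN' ▸ hq
  obtain ⟨φ, hφ, hφD, hφF⟩ := exists_isArithFrobAt_mem_kerSubgroup W K hK κ hκ hqE v hv
  intro h0
  apply res_kappa_layer_zero_ne_zero_of_isUnit_lam_adicCompletionPrime hB hN hK.1 hmq hq hqm hv hφ hφD hφF hlam
  rw [h0, map_zero]

/-- **At the root: a unit `λ_1(q)(0)` at ANY single `1`-admissible prime `q` forces `κ_1(1)_0 ≠ 0`** (`K` imaginary quadratic, `κ`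
anticyclotomic, level `N = N_E`).  LEAD g24's `kappa_one_layer_zero_ne_zero_of_isUnit_lam` with NO local witness hypothesis: the `d = 1` rank-0
anchor ⟹ the core root, for the pinned system, with no Selmer or visibility input. [cite: Howard2006, Thm. 3.2.3 (c)] [cite: CastellaEtAl2025, (7.2), Thm. 7.4, Thm. 7.5] -/
theorem kappa_one_layer_zero_ne_zero_of_isUnit_lam_adicCompletionPrime (hB : IsSignedBipartiteSystem W K p κ γ N ε B)
    (hN : (N : ℤ) = W.conductorNorm ℤ) (hK : IsImaginaryQuadratic K) (hκ : κ.IsAnticyclotomic) {q : ℕ}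
    (hq : IsAdmissiblePrime N K (fun ℓ ↦ W.frobeniusTrace ℓ) p 1 q)
    (hlam : IsUnit (PowerSeries.constantCoeff (B.lam 1 q))) : B.kappa 1 1 0 ≠ 0 := by
  have hqprime : q.Prime := hq.prime
  have hmq : 1 * q ∈ defProducts N K (fun ℓ ↦ W.frobeniusTrace ℓ) p 1 := by
    rw [one_mul]; exact mem_defProducts_of_isAdmissiblePrime hq
  -- the place of `K` over the inert `q` is `(q)` itself
  have hbot : Ideal.span {((q : ℕ) : 𝓞 K)} ≠ ⊥ := by
    rw [Ne, Ideal.span_singleton_eq_bot]; exact_mod_cast hqprime.ne_zero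
  obtain ⟨v, hv⟩ : ∃ v : HeightOneSpectrum (𝓞 K), ((q : ℕ) : 𝓞 K) ∈ v.asIdeal :=
    ⟨⟨Ideal.span {((q : ℕ) : 𝓞 K)}, hq.2.2.1, hbot⟩, Ideal.mem_span_singleton_self _⟩
  have h := kappa_layer_zero_ne_zero_of_isUnit_lam_mul_adicCompletionPrime hB hN hK hκ hmq hq (m := 1)
    (fun hd ↦ hqprime.ne_one (Nat.dvd_one.mp hd)) hv (by rw [one_mul]; exact hlam)
  exact h

/-- **The same for the limit base class** (`B.IsLimitBaseClass z`: `z_{0,1} = κ_1(1)_0`): **a unit `λ_1(q)(0)` at ONE `1`-admissible prime `q`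
forces `z_{0,1} ≠ 0`** — LEAD g25's `limitBaseClass_layer_zero_one_ne_zero_of_seenAnchor` with the non-zero class `x` and the «seen» condition
REMOVED: the `d = 1` anchor at any single vertex adjacent to the root gives the (RV₁)H-pinned conclusion of `Lines/admdef.lean` (v22 record).
[cite: CastellaEtAl2025, (7.2), Thm. 7.4 second law, Thm. 7.5] [cite: Howard2006, §3.2 (16), Thm. 3.2.3 (c)] -/
theorem limitBaseClass_layer_zero_one_ne_zero_of_isUnit_lam_adicCompletionPrime (hB : IsSignedBipartiteSystem W K p κ γ N ε B)
    {z : Π n j : ℕ, (W.baseChange K).torsionH1Over ((p : ℤ) ^ j) (κ.layerSubgroup n)} (hz : B.IsLimitBaseClass z)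
    (hN : (N : ℤ) = W.conductorNorm ℤ) (hK : IsImaginaryQuadratic K) (hκ : κ.IsAnticyclotomic) {q : ℕ}
    (hq : IsAdmissiblePrime N K (fun ℓ ↦ W.frobeniusTrace ℓ) p 1 q)
    (hlam : IsUnit (PowerSeries.constantCoeff (B.lam 1 q))) : z 0 1 ≠ 0 := by
  rw [hz 0 1 one_pos]
  exact kappa_one_layer_zero_ne_zero_of_isUnit_lam_adicCompletionPrime hB hN hK hκ hq hlam

/-- **Hence: `B.HasUnitLambda N` witnessed at level `j = 1` by a SINGLE admissible prime gives `z_{0,1} ≠ 0`** — the `d = 1` case of Howard's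
criterion «a unit `λ` somewhere ⟹ the base class is non-zero at the bottom» for the pinned system, unconditionally in kernel.
[cite: CastellaEtAl2025, Thm. 7.5 (arXiv:2308.10474v2 p0031 L17–L20)] [cite: Howard2006, Thm. 3.2.3 (c)] -/
theorem limitBaseClass_layer_zero_one_ne_zero_of_exists_prime_isUnit_lam (hB : IsSignedBipartiteSystem W K p κ γ N ε B)
    {z : Π n j : ℕ, (W.baseChange K).torsionH1Over ((p : ℤ) ^ j) (κ.layerSubgroup n)} (hz : B.IsLimitBaseClass z)
    (hN : (N : ℤ) = W.conductorNorm ℤ) (hK : IsImaginaryQuadratic K) (hκ : κ.IsAnticyclotomic)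
    (hunit : ∃ q : ℕ, IsAdmissiblePrime N K (fun ℓ ↦ W.frobeniusTrace ℓ) p 1 q ∧ IsUnit (PowerSeries.constantCoeff (B.lam 1 q))) :
    z 0 1 ≠ 0 := by
  obtain ⟨q, hq, hlam⟩ := hunit
  exact limitBaseClass_layer_zero_one_ne_zero_of_isUnit_lam_adicCompletionPrime hB hz hN hK hκ hq hlam

end Descent

end Summit.BirchSwinnertonDyer.BirchSwinnertonDyer.Theorems.SignedBaseChangeAcDivAdmdefUnrLineNonzero

end
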